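import Summits.ABC.IUTFork.Joshi.TestGenuinePinsVacuityDegreeCutMinkowski
import Summits.ABC.IUTFork.Joshi.TestGenuinePinsVacuitySqrtThree
import Literature.IUT.LogVolume.AdjoinCubeRootOfUnityDiscriminant
import HarnessLib

/-!
# Branch E TEST — the genuine-carrier pins are KERNEL-EMPTY in EVERY degree `≥ 2`: `PinnedRegions ⇒ F = ℚ`
# (R-J row Y-26, E-ROW R-55 «ALL-DEGREES CUT VIA F(ζ₃)»)

Proof-only sequel (abc-iut cell, D-0079 R-J «Joshi Y-discharge census», row Y-26; seat abc-iut-f-045, gen 7; 0 definitions, no `Prop`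
fact, FACT rows used: none; abc-iut-E-plan's RULING 2026-08-27T05:28Z, E-ROW R-55, second hand abc-iut-f-072) to abc-iut-E-t32's
`Joshi/TestGenuinePinsVacuityDegreeCut{,Minkowski}.lean` (p494605/p495931: pins ⇒ `|d_F| = 4^b·3^a`, `2b ≤ [F:ℚ]`, every place over
`3` unramified or `(2,1)`, `[F:ℚ] ∈ {1, 4, 6}`), abc-iut-E-t41's `Joshi/TestGenuinePinsDividingLine.lean` (p489924, the fixed-ball shape list),
abc-iut-E-t43's `Joshi/TestGenuinePinsVacuitySqrtThree.lean` (p488653: `√d ∈ F`, `d` non-square ⇒ EMPTY) and this seat's classical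
`Literature/IUT/LogVolume/AdjoinCubeRootOfUnity{Different,Discriminant}.lean` (the degree-doubling cut).  THIS FILE:

* **`not_pinnedRegions_settingPrVolSharp_of_four_le_finrank`** — EVERY number field with `4 ≤ [F:ℚ]` has KERNEL-EMPTY pins at
  abc-iut-c312-7's `settingPrVolSharp` over `LatticeSituation.ofShells (logShellsDH X (analyticLogv F)) …` (analytic logarithms, every
  `X`, `ρ`, `qK`, column data, `Ψ`, ideles, column): by E-t32 the pins force `|d_F| = 4^b 3^a ≤ 2^{[F:ℚ]} 3^a` and the `(2,1)`/unramified
  shape over `3`, so `AdjoinCubeRoot.exists_sq_eq_neg_three_of_four_le_finrank` gives `s ∈ F` with `s² = −3` — if `−3 ∉ F²` then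
  `E = F(ζ₃)` would be a number field of degree `2[F:ℚ] ≥ 8` with `|d_E| = N(𝔇(𝓞_E/𝓞_F))·d_F² ≤ 3^{[F:ℚ]−2a}·(2^{[F:ℚ]}3^a)² = 12^{[E:ℚ]/2}`,
  against Minkowski's `12^{[E:ℚ]} < d_E²` at `[E:ℚ] ≥ 7` (abc-iut-f-072's `twelve_pow_lt_discr_sq`) — and `√−3 ∈ F` is p488653's case;
* **`finrank_eq_one_of_pinnedRegions_settingPrVolSharp`** — hence, with E-t32's `finrank_eq_of_pinnedRegions_settingPrVolSharp`
  (`[F:ℚ] ∈ {1, 4, 6}`): `PinnedRegions ⇒ [F:ℚ] = 1`, i.e. **`F = ℚ`**; contrapositive `not_pinnedRegions_settingPrVolSharp_of_one_lt_finrank_unconditional`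
  — EVERY number field `F ≠ ℚ` has KERNEL-EMPTY pins; the `PinnedRegions3` forms.

CONSEQUENCE FOR THE RECORD (tree currency, no side taken): the kernel residual class of row Y-26 is now EMPTY — «pins at the genuine
carrier INHABITED (abc-iut-E-t41 p463284/p463655, `F = ℚ`) ⟺ `F = ℚ`», with NO located residue: no Galois closure, no resolvent, no
square-class congruence, no Mayer/Pohst/Diaz y Diaz table, no Odlyzko bound, no completion-level argument (the relative different of
`F(ζ₃)/F` is coprime to `2` because `disc(X²+X+1) = −3`, so nothing dyadic enters).  HONEST SCOPE: OUR interface's pins at OUR sharp real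
container under Dupuy–Hilado's typed (Ind2); print's (xi-e)/(xi-f) untouched; locates / conditionally verifies; no abc claim.
[claim: Mochizuki2012, status: disputed] [cite: DupuyHilado2025, §4.9] [cite: NeukirchANT1999, Ch. III Thm. (2.6), Cor. (2.10), Thm. (2.14)]
[cite: EsmondeMurty1999, Ex. 6.5.21 p. 93]
-/

noncomputable section

open Set Function NumberField IsDedekindDomain Metric
open scoped Pointwise Classical

namespace Summit.ABC.IUTFork.Joshi

open Thm311 Thm311.Real Cor312 Cor312Vol Literature.IUT.LogThetaLattice Literature.IUT.LogVolume
  Literature.IUT.HodgeTheaters Literature.NumberTheory.NumberFields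
open Literature.NumberTheory.GaloisRepresentations.Ultrametric
open GenuinePinsResidual GenuinePinsDividingLine

variable {F : Type} [Field F] [NumberField F] (X : PilotData F)
  (M : Type) [Field M] [NumberField M]
  (archPk : ∀ (j : (thetaIndex X).Label) (vQ : (thetaIndex X).VQ), Set ((logShellsDH X (analyticLogv F)).Packet j vQ))
  (archSub : ∀ (j : (thetaIndex X).Label) (v : (thetaIndex X).V),
    Set ((logShellsDH X (analyticLogv F)).Packet j ((thetaIndex X).over v)))
  (Ψ : ℤ → ∀ v : (thetaIndex X).V, v ∈ (thetaIndex X).Vbad → Set ((logShellsDH X (analyticLogv F)).StarPacket v))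
  (act : ℤ → ∀ v : (thetaIndex X).V, v ∈ (thetaIndex X).Vbad →
    (logShellsDH X (analyticLogv F)).StarPacket v → Module.End ℚ ((logShellsDH X (analyticLogv F)).StarPacket v))
  (Mmod : ℤ → ∀ j : (thetaIndex X).LabelStar, Set ((logShellsDH X (analyticLogv F)).GlobalPacket j.1))
  (region : ℤ → ∀ j : (thetaIndex X).LabelStar, FinDivisor M → ∀ vQ : (thetaIndex X).VQ,
    Set ((logShellsDH X (analyticLogv F)).Packet j.1 vQ))
  (frobAdm : ℤ → ℤ → ∀ (j : (thetaIndex X).Label) (vQ : (thetaIndex X).VQ),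
    Set ((logShellsDH X (analyticLogv F)).Packet j vQ) → Prop)
  (frobLogvol : ℤ → ℤ → ∀ (j : (thetaIndex X).Label) (vQ : (thetaIndex X).VQ),
    Set ((logShellsDH X (analyticLogv F)).Packet j vQ) → ℝ)
  (frobΨ : ℤ → ℤ → ∀ v : (thetaIndex X).V, v ∈ (thetaIndex X).Vbad → Set ((logShellsDH X (analyticLogv F)).StarPacket v))
  (frobMmod : ℤ → ℤ → ∀ j : (thetaIndex X).LabelStar, Set ((logShellsDH X (analyticLogv F)).GlobalPacket j.1))
  (unitImage : ℤ → ℤ → ℕ → ∀ (j : (thetaIndex X).Label) (vQ : (thetaIndex X).VQ),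
    Set ((logShellsDH X (analyticLogv F)).Packet j vQ))
  (ballImage : ℤ → ℤ → ∀ (j : (thetaIndex X).Label) (vQ : (thetaIndex X).VQ),
    Set ((logShellsDH X (analyticLogv F)).Packet j vQ))
  (thetaDiv : ℤ → ℤ → LgpDivisor M (thetaIndex X).lstar)
  (n : ℤ) {HT : Type} {LogLink : HT → HT → Type} {IsFull : ∀ {s t : HT}, LogLink s t → Prop}
  (lat : LGPGaussianLogThetaLattice LogLink IsFull)
  {Frd : Type} {IsoF : Frd → Frd → Type} {Ob : Frd → Type} {realify : Frd → Frd} {Strip : Type}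
  {IsoS : Strip → Strip → Type} {Mv : ∀ v : (thetaIndex X).V, v ∈ (thetaIndex X).Vbad → Type}
  [∀ v h, Monoid (Mv v h)]
  (sig : GlobalLGPFrobenioidSignature (thetaIndex X).lstar (thetaIndex X).V (· ∈ (thetaIndex X).Vbad)
    Frd IsoF Ob realify Strip IsoS Mv)
  (split : SplittingMonoids Mv) {ObΔ : Type} {N : ∀ v : (thetaIndex X).V, v ∈ (thetaIndex X).Vbad → Type}
  [∀ v h, Monoid (N v h)] (qData : QPilotData ObΔ N)
  (t : ∀ (pp : Nat.Primes) (_ : Fin X.lstar) (x : (thetaIndex X).Fibre (.inr pp)),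
    haveI : Fact (pp : ℕ).Prime := ⟨pp.2⟩; kOf X pp.1 x)
  (tq : ∀ (pp : Nat.Primes) (x : (thetaIndex X).Fibre (.inr pp)), haveI : Fact (pp : ℕ).Prime := ⟨pp.2⟩; kOf X pp.1 x)
  (ρ : (∀ v : (thetaIndex X).V, v ∈ (thetaIndex X).Vbad → Set ((logShellsDH X (analyticLogv F)).StarPacket v)) →
    ∀ (j : (thetaIndex X).Label) (vQ : (thetaIndex X).VQ), Set ((logShellsDH X (analyticLogv F)).Packet j vQ))
  (qK : ∀ v : (thetaIndex X).V, v ∈ (thetaIndex X).Vbad → Set ((logShellsDH X (analyticLogv F)).StarPacket v))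
  (htq0 : ∀ pp x, tq pp x ≠ 0)
  (htq1 : ∀ (pp : Nat.Primes) (x : (thetaIndex X).Fibre (.inr pp)),
    haveI : Fact (pp : ℕ).Prime := ⟨pp.2⟩; placeOf X pp.1 x ∉ X.S → ‖tq pp x‖ = 1)


/-- **EVERY NUMBER FIELD WITH `4 ≤ [F:ℚ]` HAS KERNEL-EMPTY PINS at `settingPrVolSharp`** (analytic logarithms, every `X`, `ρ`, `qK`,
column data, `Ψ`, ideles, column): E-t32's pinned discriminant `|d_F| = 4^b·3^a`, `2b ≤ [F:ℚ]` and the shape over `3` feed the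
degree-doubling cut `AdjoinCubeRoot.exists_sq_eq_neg_three_of_four_le_finrank` (`√−3 ∈ F`), and `√−3 ∈ F` is abc-iut-E-t43's p488653.
[cite: DupuyHilado2025, §4.9] [cite: NeukirchANT1999, Ch. III Cor. (2.10), Thm. (2.14)] [claim: Mochizuki2012, status: disputed] -/
theorem not_pinnedRegions_settingPrVolSharp_of_four_le_finrank (h4 : 4 ≤ Module.finrank ℚ F) :
    ¬ Cor312Vol.PinnedRegions
      (LatticeSituation.ofShells (logShellsDH X (analyticLogv F)) M archPk archSub
        (summandPiecesPr X (logvAnalytic_analyticLogv (F := F))).Adm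
        (summandPiecesPr X (logvAnalytic_analyticLogv (F := F))).logvol Ψ act Mmod region frobAdm frobLogvol frobΨ frobMmod
        unitImage ballImage thetaDiv)
      (settingPrVolSharp X (logvAnalytic_analyticLogv (F := F)) M archPk archSub Ψ act Mmod region n lat sig split qData tq t
        htq0 htq1) ρ qK := by
  intro hpin
  haveI : Fact (Nat.Prime 3) := ⟨Nat.prime_three⟩
  have hd := natAbs_discr_eq_of_pinnedRegions_settingPrVolSharp X M archPk archSub Ψ act Mmod region frobAdm frobLogvol frobΨ
      frobMmod unitImage ballImage thetaDiv n lat sig split qData t tq ρ qK htq0 htq1 hpin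
  have h2b := two_mul_card_ramifiedTwo_le_of_pinnedRegions_settingPrVolSharp X M archPk archSub Ψ act Mmod region frobAdm frobLogvol frobΨ
      frobMmod unitImage ballImage thetaDiv n lat sig split qData t tq ρ qK htq0 htq1 hpin
  have h3 := fixedBallShapes_three_of_pinnedRegions_settingPrVolSharp X M archPk archSub Ψ act Mmod region frobAdm frobLogvol frobΨ
      frobMmod unitImage ballImage thetaDiv n lat sig split qData t tq ρ qK htq0 htq1 hpin
  have hd' : (NumberField.discr F).natAbs ≤ 2 ^ Module.finrank ℚ F *
      3 ^ ((placesOver F 3).filter fun v => v.asIdeal.ramificationIdx ℤ = 2).card := by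
    rw [hd, show (4 : ℕ) = 2 ^ 2 by norm_num, ← pow_mul]
    exact Nat.mul_le_mul_right _ (Nat.pow_le_pow_right two_pos h2b)
  obtain ⟨s, hs⟩ := AdjoinCubeRoot.exists_sq_eq_neg_three_of_four_le_finrank F h4 h3 hd'
  exact not_pinnedRegions_settingPrVolSharp_of_sq_eq_of_not_isSquare X M archPk archSub Ψ act Mmod region frobAdm frobLogvol frobΨ
      frobMmod unitImage ballImage thetaDiv n lat sig split qData t tq ρ qK htq0 htq1 (s := s) (d := -3) (by rw [hs]; norm_num)
    (fun ⟨r, hr⟩ => by nlinarith [mul_self_nonneg r]) hpin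

/-- The same for `PinnedRegions3`. [claim: Mochizuki2012, status: disputed] -/
theorem not_pinnedRegions3_settingPrVolSharp_of_four_le_finrank (h4 : 4 ≤ Module.finrank ℚ F) :
    ¬ Cor312Vol.PinnedRegions3
      (LatticeSituation.ofShells (logShellsDH X (analyticLogv F)) M archPk archSub
        (summandPiecesPr X (logvAnalytic_analyticLogv (F := F))).Adm
        (summandPiecesPr X (logvAnalytic_analyticLogv (F := F))).logvol Ψ act Mmod region frobAdm frobLogvol frobΨ frobMmod
        unitImage ballImage thetaDiv)
      (settingPrVolSharp X (logvAnalytic_analyticLogv (F := F)) M archPk archSub Ψ act Mmod region n lat sig split qData tq t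
        htq0 htq1) ρ qK :=
  fun h => not_pinnedRegions_settingPrVolSharp_of_four_le_finrank X M archPk archSub Ψ act Mmod region frobAdm frobLogvol frobΨ
      frobMmod unitImage ballImage thetaDiv n lat sig split qData t tq ρ qK htq0 htq1 h4 h.1

/-- **`PinnedRegions` AT `settingPrVolSharp` ⇒ `[F:ℚ] = 1`, i.e. `F = ℚ`**: E-t32's degree cut `[F:ℚ] ∈ {1, 4, 6}`
(`finrank_eq_of_pinnedRegions_settingPrVolSharp`) and the all-degrees cut above.  The `F = ℚ` side is INHABITED (abc-iut-E-t41's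
p463284/p463655). [cite: DupuyHilado2025, §4.9] [cite: NeukirchANT1999, Ch. III Thm. (2.14)] [claim: Mochizuki2012, status: disputed] -/
theorem finrank_eq_one_of_pinnedRegions_settingPrVolSharp
    (hpin : Cor312Vol.PinnedRegions
      (LatticeSituation.ofShells (logShellsDH X (analyticLogv F)) M archPk archSub
        (summandPiecesPr X (logvAnalytic_analyticLogv (F := F))).Adm
        (summandPiecesPr X (logvAnalytic_analyticLogv (F := F))).logvol Ψ act Mmod region frobAdm frobLogvol frobΨ frobMmod
        unitImage ballImage thetaDiv)
      (settingPrVolSharp X (logvAnalytic_analyticLogv (F := F)) M archPk archSub Ψ act Mmod region n lat sig split qData tq t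
        htq0 htq1) ρ qK) :
    Module.finrank ℚ F = 1 := by
  rcases finrank_eq_of_pinnedRegions_settingPrVolSharp X M archPk archSub Ψ act Mmod region frobAdm frobLogvol frobΨ
      frobMmod unitImage ballImage thetaDiv n lat sig split qData t tq ρ qK htq0 htq1 hpin with h1 | h4 | h6
  · exact h1
  · exact absurd hpin (not_pinnedRegions_settingPrVolSharp_of_four_le_finrank X M archPk archSub Ψ act Mmod region frobAdm frobLogvol frobΨ
      frobMmod unitImage ballImage thetaDiv n lat sig split qData t tq ρ qK htq0 htq1 (by omega))
  · exact absurd hpin (not_pinnedRegions_settingPrVolSharp_of_four_le_finrank X M archPk archSub Ψ act Mmod region frobAdm frobLogvol frobΨ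
      frobMmod unitImage ballImage thetaDiv n lat sig split qData t tq ρ qK htq0 htq1 (by omega))

/-- The same read from `PinnedRegions3`. [claim: Mochizuki2012, status: disputed] -/
theorem finrank_eq_one_of_pinnedRegions3_settingPrVolSharp
    (hpin : Cor312Vol.PinnedRegions3
      (LatticeSituation.ofShells (logShellsDH X (analyticLogv F)) M archPk archSub
        (summandPiecesPr X (logvAnalytic_analyticLogv (F := F))).Adm
        (summandPiecesPr X (logvAnalytic_analyticLogv (F := F))).logvol Ψ act Mmod region frobAdm frobLogvol frobΨ frobMmod
        unitImage ballImage thetaDiv)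
      (settingPrVolSharp X (logvAnalytic_analyticLogv (F := F)) M archPk archSub Ψ act Mmod region n lat sig split qData tq t
        htq0 htq1) ρ qK) :
    Module.finrank ℚ F = 1 :=
  finrank_eq_one_of_pinnedRegions_settingPrVolSharp X M archPk archSub Ψ act Mmod region frobAdm frobLogvol frobΨ
      frobMmod unitImage ballImage thetaDiv n lat sig split qData t tq ρ qK htq0 htq1 hpin.1

/-- **EVERY NUMBER FIELD `F ≠ ℚ` HAS KERNEL-EMPTY PINS at `settingPrVolSharp`** (analytic logarithms, every `X`, `ρ`, `qK`, column
data, `Ψ`, ideles, column) — the Y-26 residual class is EMPTY. [cite: DupuyHilado2025, §4.9] [claim: Mochizuki2012, status: disputed] -/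
theorem not_pinnedRegions_settingPrVolSharp_of_one_lt_finrank_unconditional (hF : 1 < Module.finrank ℚ F) :
    ¬ Cor312Vol.PinnedRegions
      (LatticeSituation.ofShells (logShellsDH X (analyticLogv F)) M archPk archSub
        (summandPiecesPr X (logvAnalytic_analyticLogv (F := F))).Adm
        (summandPiecesPr X (logvAnalytic_analyticLogv (F := F))).logvol Ψ act Mmod region frobAdm frobLogvol frobΨ frobMmod
        unitImage ballImage thetaDiv)
      (settingPrVolSharp X (logvAnalytic_analyticLogv (F := F)) M archPk archSub Ψ act Mmod region n lat sig split qData tq t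
        htq0 htq1) ρ qK :=
  fun hpin => absurd (finrank_eq_one_of_pinnedRegions_settingPrVolSharp X M archPk archSub Ψ act Mmod region frobAdm frobLogvol frobΨ
      frobMmod unitImage ballImage thetaDiv n lat sig split qData t tq ρ qK htq0 htq1 hpin) (by omega)

/-- The same for `PinnedRegions3`. [claim: Mochizuki2012, status: disputed] -/
theorem not_pinnedRegions3_settingPrVolSharp_of_one_lt_finrank_unconditional (hF : 1 < Module.finrank ℚ F) :
    ¬ Cor312Vol.PinnedRegions3
      (LatticeSituation.ofShells (logShellsDH X (analyticLogv F)) M archPk archSub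
        (summandPiecesPr X (logvAnalytic_analyticLogv (F := F))).Adm
        (summandPiecesPr X (logvAnalytic_analyticLogv (F := F))).logvol Ψ act Mmod region frobAdm frobLogvol frobΨ frobMmod
        unitImage ballImage thetaDiv)
      (settingPrVolSharp X (logvAnalytic_analyticLogv (F := F)) M archPk archSub Ψ act Mmod region n lat sig split qData tq t
        htq0 htq1) ρ qK :=
  fun h => not_pinnedRegions_settingPrVolSharp_of_one_lt_finrank_unconditional X M archPk archSub Ψ act Mmod region frobAdm frobLogvol frobΨ
      frobMmod unitImage ballImage thetaDiv n lat sig split qData t tq ρ qK htq0 htq1 hF h.1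

end Summit.ABC.IUTFork.Joshi
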